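import Literature.NumberTheory.Sieve.LinearEquationsInPrimesCount
import Literature.NumberTheory.LFunctions.PrimeCountingThetaRatio
import HarnessLib

/-!
# Helpers for `LeeYangFibres.CellsToRelativeDimOne` (stmt-Parity-14115): counts and arithmetic

Support `CellsToRelativeDimOne := PrimeCellsRelative → RelativeDimOne` of route `LeeYangFibres`
(Parity / GeneralizedHardyLittlewood) is the partial-summation passage from the COUNT of points
`n ∈ K ∩ [-N, N]` all of whose values `ψᵢ(n)` are primes `> N^{1/u}` (normalised by
`β_∞ ∏_p β_p · (A₁(N)/N)^t`, `A₁(N) = #{N^{1/u} < p ≤ N}`) to the von Mangoldt sum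
`∑ ∏ᵢ Λ(ψᵢ(n))` with the relative + absolute error of Green–Tao's Conjecture 1.4. This file holds
the elementary inputs of that passage which do not mention the route file:

* `card_roughPrimes_le_primeCounting`, `primeCounting_le_card_roughPrimes_add`:
  `π(N) - Z ≤ A₁ ≤ π(N)` for the rough prime count `A₁ = #{m ≤ N : P⁻(m) > Z, Ω(m) = 1}`;
* `eventually_primeCounting_window`: by the prime number theorem
  (`Literature.NumberTheory.LFunctions.tendsto_primeCounting_mul_log_div`, proved in the tree),
  eventually every `A ∈ [π(N) - √N, π(N)]` has `(1-η)N ≤ A log N ≤ (1+η)N`;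
* `card_cells_le_primePointCount`, `primePointCount_le_card_cells_add`: the cell count
  `C = #{n : every ψᵢ(n) prime > Z}` satisfies `C ≤ #{prime points} ≤ C + t(2Z+1)` (crude count
  `card_filter_abs_eval_le` of `LinearEquationsInPrimesCountSandwich`, `d = 1`);
* `cells_arith`: the real-arithmetic heart (sandwich + cell asymptotic + small error counts
  ⟹ `|S - M| ≤ ε (M + N)`, with a case distinction on the sign of `M = β_∞ ∏_p β_p`).

The decidability instances of the filtered finsets are taken as implicit ARGUMENTS (`{hdec : …}`)
so that the lemmas apply verbatim to the finsets printed in the route file.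

References: B. Green, T. Tao, *Linear equations in primes*, Ann. of Math. 171 (2010), sketch proof
of Conj. 1.4 after (1.8); H. L. Montgomery, R. C. Vaughan, *Multiplicative Number Theory I*,
§8.1 (prime number theorem).
-/

noncomputable section

namespace Summit.Parity.GeneralizedHardyLittlewood.Theorems.LeeYangFibresCells

open Filter Finset Asymptotics Literature.NumberTheory.Sieve
open scoped Topology

/-! ### The rough prime count `A₁(N) = #{m ≤ N : P⁻(m) > Z, Ω(m) = 1}` versus `π(N)` -/

/-- The rough prime count is at most `π(N)`: an `m` with `Ω(m) = 1` is a prime. [folklore] -/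
theorem card_roughPrimes_le_primeCounting (N : ℕ) (Z : ℝ)
    {hdec : DecidablePred fun m : ℕ => Z < (Nat.minFac m : ℝ) ∧ ArithmeticFunction.cardFactors m = 1} :
    (#((Icc 1 N).filter fun m => Z < (Nat.minFac m : ℝ) ∧ ArithmeticFunction.cardFactors m = 1) : ℝ)
      ≤ Nat.primeCounting N := by
  classical
  have h : #((Icc 1 N).filter fun m => Z < (Nat.minFac m : ℝ) ∧
      ArithmeticFunction.cardFactors m = 1) ≤ Nat.primeCounting N := by
    rw [← Nat.primesLE_card_eq_primeCounting, Nat.primesLE_eq_filter_Icc_one]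
    refine Finset.card_le_card fun m hm => ?_
    rw [Finset.mem_filter] at hm ⊢
    exact ⟨hm.1, ArithmeticFunction.cardFactors_eq_one_iff_prime.mp hm.2.2⟩
  exact_mod_cast h

/-- Conversely `π(N) ≤ A₁(N) + Z` for `Z ≥ 0`: a prime `p ≤ N` not counted has `p ≤ Z`.
[folklore] -/
theorem primeCounting_le_card_roughPrimes_add (N : ℕ) {Z : ℝ} (hZ : 0 ≤ Z)
    {hdec : DecidablePred fun m : ℕ => Z < (Nat.minFac m : ℝ) ∧ ArithmeticFunction.cardFactors m = 1} :
    (Nat.primeCounting N : ℝ) ≤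
      #((Icc 1 N).filter fun m => Z < (Nat.minFac m : ℝ) ∧ ArithmeticFunction.cardFactors m = 1) +
        Z := by
  classical
  have h1 : Nat.primesLE N ⊆
      ((Icc 1 N).filter fun m => Z < (Nat.minFac m : ℝ) ∧ ArithmeticFunction.cardFactors m = 1) ∪
        Icc 1 ⌊Z⌋₊ := by
    intro p hp
    rw [Nat.mem_primesLE] at hp
    obtain ⟨hpN, hpp⟩ := hp
    rw [Finset.mem_union]
    by_cases hZp : Z < (p : ℝ)
    · left
      rw [Finset.mem_filter, Finset.mem_Icc, Nat.Prime.minFac_eq hpp]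
      exact ⟨⟨hpp.one_le, hpN⟩, hZp, ArithmeticFunction.cardFactors_apply_prime hpp⟩
    · right
      rw [Finset.mem_Icc]
      exact ⟨hpp.one_le, Nat.le_floor (le_of_not_gt hZp)⟩
  have h2 : Nat.primeCounting N ≤
      #((Icc 1 N).filter fun m => Z < (Nat.minFac m : ℝ) ∧ ArithmeticFunction.cardFactors m = 1) +
        ⌊Z⌋₊ := by
    rw [← Nat.primesLE_card_eq_primeCounting]
    refine (Finset.card_le_card h1).trans ((Finset.card_union_le _ _).trans ?_)
    rw [Nat.card_Icc, Nat.add_sub_cancel]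
  calc (Nat.primeCounting N : ℝ)
      ≤ (#((Icc 1 N).filter fun m => Z < (Nat.minFac m : ℝ) ∧
          ArithmeticFunction.cardFactors m = 1) : ℝ) + (⌊Z⌋₊ : ℝ) := by exact_mod_cast h2
    _ ≤ _ := by gcongr; exact Nat.floor_le hZ

/-- **Prime number theorem window.** For `η > 0`, eventually in `N`: every `A` with
`π(N) - √N ≤ A ≤ π(N)` satisfies `(1-η) N ≤ A log N ≤ (1+η) N`
(`π(N) log N / N → 1`, `Literature.NumberTheory.LFunctions.tendsto_primeCounting_mul_log_div`,
and `√N log N = o(N)`). [cite: MontgomeryVaughan2007, §8.1 eq. (8.1)] -/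
theorem eventually_primeCounting_window {η : ℝ} (hη : 0 < η) :
    ∀ᶠ N : ℕ in atTop, ∀ A : ℝ, (Nat.primeCounting N : ℝ) - Real.sqrt N ≤ A →
      A ≤ Nat.primeCounting N →
        (1 - η) * N ≤ A * Real.log N ∧ A * Real.log N ≤ (1 + η) * N := by
  have hPNT : Tendsto (fun N : ℕ => (Nat.primeCounting N : ℝ) * Real.log N / N) atTop (𝓝 1) := by
    have h := Literature.NumberTheory.LFunctions.tendsto_primeCounting_mul_log_div.comp
      tendsto_natCast_atTop_atTop
    refine h.congr' (Eventually.of_forall fun N => ?_)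
    simp only [Function.comp_apply, Nat.floor_natCast]
  have h1 : ∀ᶠ N : ℕ in atTop, 1 - η / 2 < (Nat.primeCounting N : ℝ) * Real.log N / N :=
    (tendsto_order.1 hPNT).1 _ (by linarith)
  have h2 : ∀ᶠ N : ℕ in atTop, (Nat.primeCounting N : ℝ) * Real.log N / N < 1 + η :=
    (tendsto_order.1 hPNT).2 _ (by linarith)
  have h3 := eventually_log_growth 0 (1 : ℝ) hη one_pos (by positivity : (0 : ℝ) < η / 2)
  filter_upwards [h1, h2, h3, eventually_ge_atTop 1] with N hlo hhi hgr hN1 A hA1 hA2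
  obtain ⟨hℓ1, -, -, hℓs⟩ := hgr
  have hN0 : (0 : ℝ) < N := by exact_mod_cast hN1
  rw [lt_div_iff₀ hN0] at hlo
  rw [div_lt_iff₀ hN0] at hhi
  simp only [zero_add, pow_one] at hℓs
  have hℓ0 : 0 ≤ Real.log N := by linarith
  have hs0 : 0 ≤ Real.sqrt (N : ℝ) := Real.sqrt_nonneg _
  have hss : Real.sqrt (N : ℝ) * Real.sqrt N = N := Real.mul_self_sqrt hN0.le
  constructor
  · have h4 : ((Nat.primeCounting N : ℝ) - Real.sqrt N) * Real.log N ≤ A * Real.log N :=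
      mul_le_mul_of_nonneg_right hA1 hℓ0
    have h5 : Real.sqrt (N : ℝ) * Real.log N ≤ Real.sqrt N * (η / 2 * Real.sqrt N) :=
      mul_le_mul_of_nonneg_left hℓs hs0
    nlinarith
  · have h4 : A * Real.log N ≤ (Nat.primeCounting N : ℝ) * Real.log N :=
      mul_le_mul_of_nonneg_right hA2 hℓ0
    linarith

/-! ### The cell count of `PrimeCellsRelative` versus the prime-point count -/

variable {t : ℕ}

/-- The cells `{n : every ψᵢ(n) a prime > Z}` (typed as `Z < P⁻(ψᵢ(n))`, `Ω(ψᵢ(n)) = 1`) are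
prime points. [folklore] -/
theorem card_cells_le_primePointCount (N : ℕ) (Z : ℝ) (Ψ : Fin t → AffLinForm 1)
    (K : Set (Fin 1 → ℝ))
    {hdec : DecidablePred fun n : Fin 1 → ℤ => realPoint n ∈ K ∧ ∀ i, Z <
      (Nat.minFac ((Ψ i).eval n).toNat : ℝ) ∧
        ArithmeticFunction.cardFactors ((Ψ i).eval n).toNat = 1} :
    (#((latticeBox 1 N).filter fun n => realPoint n ∈ K ∧ ∀ i, Z <
      (Nat.minFac ((Ψ i).eval n).toNat : ℝ) ∧
        ArithmeticFunction.cardFactors ((Ψ i).eval n).toNat = 1) : ℝ)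
      ≤ primePointCount Ψ K N := by
  classical
  have h : #((latticeBox 1 N).filter fun n => realPoint n ∈ K ∧ ∀ i, Z <
      (Nat.minFac ((Ψ i).eval n).toNat : ℝ) ∧
        ArithmeticFunction.cardFactors ((Ψ i).eval n).toNat = 1) ≤ primePointCount Ψ K N := by
    unfold primePointCount
    refine Finset.card_le_card fun n hn => ?_
    rw [Finset.mem_filter] at hn ⊢
    exact ⟨hn.1, hn.2.1, fun i => ArithmeticFunction.cardFactors_eq_one_iff_prime.mp (hn.2.2 i).2⟩
  exact_mod_cast h

/-- A prime point not in the cells has some prime value `ψᵢ(n) ≤ Z`, hence `|ψᵢ(n)| ≤ Z`; by the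
crude count there are at most `t (2Z+1)` such points (`d = 1`).
[cite: GreenTao2010, Conj. 1.4 (sketch proof)] -/
theorem primePointCount_le_card_cells_add {N : ℕ} {Z : ℝ} (hZ : 0 ≤ Z) (Ψ : Fin t → AffLinForm 1)
    (hΨ : IsNondegenerateSystem Ψ) (K : Set (Fin 1 → ℝ))
    {hdec : DecidablePred fun n : Fin 1 → ℤ => realPoint n ∈ K ∧ ∀ i, Z <
      (Nat.minFac ((Ψ i).eval n).toNat : ℝ) ∧
        ArithmeticFunction.cardFactors ((Ψ i).eval n).toNat = 1} :
    (primePointCount Ψ K N : ℝ) ≤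
      #((latticeBox 1 N).filter fun n => realPoint n ∈ K ∧ ∀ i, Z <
        (Nat.minFac ((Ψ i).eval n).toNat : ℝ) ∧
          ArithmeticFunction.cardFactors ((Ψ i).eval n).toNat = 1) + t * (2 * Z + 1) := by
  classical
  set KB : Finset (Fin 1 → ℤ) := (latticeBox 1 N).filter fun n => realPoint n ∈ K with hKB
  have hKBsub : KB ⊆ latticeBox 1 N := Finset.filter_subset _ _
  set Cset := (latticeBox 1 N).filter fun n => realPoint n ∈ K ∧ ∀ i, Z <
      (Nat.minFac ((Ψ i).eval n).toNat : ℝ) ∧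
        ArithmeticFunction.cardFactors ((Ψ i).eval n).toNat = 1 with hCset
  set B : Finset (Fin 1 → ℤ) := Finset.univ.biUnion fun i : Fin t =>
    KB.filter fun n => |((Ψ i).eval n : ℝ)| ≤ Z with hB
  have hsub : (latticeBox 1 N).filter (fun n => realPoint n ∈ K ∧ ∀ i, ((Ψ i).eval n).toNat.Prime)
      ⊆ Cset ∪ B := by
    intro n hn
    rw [Finset.mem_filter] at hn
    obtain ⟨hnbox, hnK, hprime⟩ := hn
    rw [Finset.mem_union]
    by_cases hc : ∀ i, Z < (Nat.minFac ((Ψ i).eval n).toNat : ℝ) ∧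
        ArithmeticFunction.cardFactors ((Ψ i).eval n).toNat = 1
    · left
      rw [hCset, Finset.mem_filter]
      exact ⟨hnbox, hnK, hc⟩
    · right
      obtain ⟨i, hi⟩ := not_forall.mp hc
      have hp := hprime i
      have hle : (((Ψ i).eval n).toNat : ℝ) ≤ Z := by
        by_contra hlt
        refine hi ⟨?_, ArithmeticFunction.cardFactors_apply_prime hp⟩
        rw [Nat.Prime.minFac_eq hp]
        exact lt_of_not_ge hlt
      rw [hB, Finset.mem_biUnion]
      refine ⟨i, Finset.mem_univ i, Finset.mem_filter.mpr ⟨?_, ?_⟩⟩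
      · rw [hKB, Finset.mem_filter]
        exact ⟨hnbox, hnK⟩
      · have hcast : ((((Ψ i).eval n).toNat : ℕ) : ℝ) = ((Ψ i).eval n : ℝ) :=
          cast_toNat_of_two_le hp.two_le
        rw [← hcast, abs_of_nonneg (Nat.cast_nonneg _)]
        exact hle
  have h1 : primePointCount Ψ K N ≤ #Cset + #B := by
    unfold primePointCount
    exact (Finset.card_le_card hsub).trans (Finset.card_union_le _ _)
  have h2 : (#B : ℝ) ≤ t * (2 * Z + 1) := by
    calc (#B : ℝ) ≤ ∑ i : Fin t, (#(KB.filter fun n => |((Ψ i).eval n : ℝ)| ≤ Z) : ℝ) := by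
          rw [hB]
          exact_mod_cast Finset.card_biUnion_le
      _ ≤ ∑ _i : Fin t, (2 * Z + 1) * (2 * N + 1) ^ (1 - 1) :=
          Finset.sum_le_sum fun i _ => card_filter_abs_eval_le hZ (Ψ i) (hΨ.1 i) KB hKBsub
      _ = t * (2 * Z + 1) := by
          simp only [Nat.sub_self, pow_zero, mul_one, Finset.sum_const, Finset.card_univ,
            Fintype.card_fin, nsmul_eq_mul]
  calc (primePointCount Ψ K N : ℝ) ≤ (#Cset : ℝ) + (#B : ℝ) := by exact_mod_cast h1
    _ ≤ _ := by linarith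

/-! ### The arithmetic heart -/

/-- **Arithmetic heart.** With `a = ε₀/16`: from the sandwich `(1-a)·Tg ≤ S ≤ (1+a)(Tg+Tb+Tc)`,
the comparison `TC - Tb ≤ Tg ≤ TC + Tb2` of good points with the cell count, the cell asymptotic
`|TC - MK| ≤ a (MK + X)` (`MK = κ M`, `κ ∈ [1-a, 1+a]`) and the smallness `Tb + Tc + Tb2 ≤ a X`
of the error counts, `|S - M| ≤ ε (M + X)` follows for `16 a ≤ ε`, `16 a ≤ 1` (case distinction
on the sign of `M`; for `M < 0` the cell asymptotic and `TC ≥ 0` force `|M| = O(a X)`). Every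
step is linear in the displayed monomials. [folklore] -/
theorem cells_arith {ε ε₀ S M X Tg Tb Tc Tb2 TC MK : ℝ}
    (hε₀ : 0 < ε₀) (hε₀1 : ε₀ ≤ 1) (hε₀ε : ε₀ ≤ ε) (hX : 0 < X)
    (hTg : 0 ≤ Tg) (hTb : 0 ≤ Tb) (hTc : 0 ≤ Tc) (hTb2 : 0 ≤ Tb2) (hTC : 0 ≤ TC)
    (hS1 : (1 - ε₀ / 16) * Tg ≤ S) (hS2 : S ≤ (1 + ε₀ / 16) * (Tg + Tb + Tc))
    (hG1 : TC - Tb ≤ Tg) (hG2 : Tg ≤ TC + Tb2)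
    (hP : |TC - MK| ≤ ε₀ / 16 * (MK + X))
    (hKp : 0 ≤ M → (1 - ε₀ / 16) * M ≤ MK ∧ MK ≤ (1 + ε₀ / 16) * M)
    (hKn : M < 0 → (1 + ε₀ / 16) * M ≤ MK ∧ MK ≤ (1 - ε₀ / 16) * M)
    (hE : Tb + Tc + Tb2 ≤ ε₀ / 16 * X) :
    |S - M| ≤ ε * (M + X) := by
  obtain ⟨hP1, hP2⟩ := abs_le.mp hP
  have e1 : ε₀ * Tg ≤ ε₀ * (TC + Tb2) := mul_le_mul_of_nonneg_left hG2 hε₀.le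
  have e2 : ε₀ * (TC - MK) ≤ ε₀ * (ε₀ / 16 * (MK + X)) := mul_le_mul_of_nonneg_left hP2 hε₀.le
  have e3 : ε₀ * (Tb + Tc + Tb2) ≤ ε₀ * (ε₀ / 16 * X) := mul_le_mul_of_nonneg_left hE hε₀.le
  have e4 : ε₀ * (ε₀ * X) ≤ 1 * (ε₀ * X) := mul_le_mul_of_nonneg_right hε₀1 (by positivity)
  have e5 : ε₀ * Tg ≤ 1 * Tg := mul_le_mul_of_nonneg_right hε₀1 hTg
  have e6 : ε₀ * X ≤ 1 * X := mul_le_mul_of_nonneg_right hε₀1 hX.le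
  have n1 : 0 ≤ ε₀ * Tb := by positivity
  have n2 : 0 ≤ ε₀ * Tc := by positivity
  have n3 : 0 ≤ ε₀ * Tb2 := by positivity
  have n4 : 0 ≤ ε₀ * Tg := by positivity
  have n5 : 0 ≤ ε₀ * TC := by positivity
  have n6 : 0 ≤ ε₀ * X := by positivity
  have hS0 : 0 ≤ S := by linarith
  rcases le_or_gt 0 M with hM | hM
  · obtain ⟨k1, k2⟩ := hKp hM
    have m1 : ε₀ * MK ≤ ε₀ * ((1 + ε₀ / 16) * M) := mul_le_mul_of_nonneg_left k2 hε₀.le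
    have m2 : ε₀ * ((1 - ε₀ / 16) * M) ≤ ε₀ * MK := mul_le_mul_of_nonneg_left k1 hε₀.le
    have m3 : ε₀ * (ε₀ * M) ≤ 1 * (ε₀ * M) :=
      mul_le_mul_of_nonneg_right hε₀1 (mul_nonneg hε₀.le hM)
    have m4 : ε₀ * M ≤ 1 * M := mul_le_mul_of_nonneg_right hε₀1 hM
    have m5 : 0 ≤ ε₀ * M := mul_nonneg hε₀.le hM
    have hMK0 : 0 ≤ MK := by linarith
    have m6 : ε₀ * (ε₀ * MK) ≤ 1 * (ε₀ * MK) :=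
      mul_le_mul_of_nonneg_right hε₀1 (mul_nonneg hε₀.le hMK0)
    have hfin : ε₀ * (M + X) ≤ ε * (M + X) := mul_le_mul_of_nonneg_right hε₀ε (by linarith)
    rw [abs_le]
    constructor
    · linarith
    · linarith
  · obtain ⟨k1, k2⟩ := hKn hM
    have q3 : 1 * M ≤ ε₀ * M := mul_le_mul_of_nonpos_right hε₀1 hM.le
    have q3' : ε₀ * M ≤ 0 := mul_nonpos_of_nonneg_of_nonpos hε₀.le hM.le
    have hMK : MK < 0 := by linarith
    have q5 : ε₀ * MK ≤ 0 := mul_nonpos_of_nonneg_of_nonpos hε₀.le hMK.le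
    have q6 : ε₀ * (ε₀ * MK) ≤ 0 := mul_nonpos_of_nonneg_of_nonpos hε₀.le q5
    have q7 : 1 * (ε₀ * M) ≤ ε₀ * (ε₀ * M) := mul_le_mul_of_nonpos_right hε₀1 q3'
    have q8 : (1 + ε₀ / 16) * MK ≤ (1 + ε₀ / 16) * ((1 - ε₀ / 16) * M) :=
      mul_le_mul_of_nonneg_left k2 (by positivity)
    have hnegM : -M ≤ 256 / 255 * (ε₀ / 16 * X) := by linarith
    have q9 : ε₀ * (-M) ≤ ε₀ * (256 / 255 * (ε₀ / 16 * X)) :=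
      mul_le_mul_of_nonneg_left hnegM hε₀.le
    have hMX : 0 ≤ M + X := by linarith
    have hfin : ε₀ * (M + X) ≤ ε * (M + X) := mul_le_mul_of_nonneg_right hε₀ε hMX
    rw [abs_of_nonneg (by linarith)]
    linarith

end Summit.Parity.GeneralizedHardyLittlewood.Theorems.LeeYangFibresCells
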